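import Mathlib
import Summits.Parity.BatemanHorn.Theses.PolynomialMobius

/-!
# Sketch — crux-ideate stmt-Parity-0870 (PolyMobiusTail), round 1, ideator 2

First-lemma signatures for the two idea cards (they must ELABORATE; proofs are not required here).

* Card `natural-log-cutoff-normal-form` (transfer): `NaturalLogTail` (C⁺) and the two
  theorem-grade bridges `RouteTailToNaturalTail` (pointwise Λ = μ∗log bookkeeping + Landau's
  theorem for `∑ μ(d)ρ(d)/d`) and `NaturalStripNegligible` (the strip `x^{1-η} < ∏ dᵢ ≤ x/(log x)^B`
  is Type-I-trivial).
* Card `affine-twist-sw-hooley-window` (lever on the log-window): `AffineTwistRootSum`, the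
  reindexing identity turning a Kloosterman-twisted root sum of `f` modulo `ℓ` into a plain root sum
  of the affine twist `G_{c,c',q} = ∑ aᵢ c^{g-i} (qX - c')^i`, and the target `SWHooleyAffine`.
-/

open scoped BigOperators
open Filter Finset Polynomial

namespace Summit.Parity.BatemanHorn.Cruxes.PolyMobiusTail.Ideator2

/-- The route's tail summand at cut-off `y` (so that `PolyMobiusTail` is the case `y = x^{1-η}`):
`∑_{d ∈ ∏ divisors(fᵢ(n)), y < ∏ dᵢ} ∏ᵢ μ(dᵢ) log dᵢ`. -/
noncomputable def routeTailAt {k : ℕ} (f : Fin k → ℤ[X]) (y : ℝ) (n : ℕ) : ℝ :=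
  ∑ d ∈ Fintype.piFinset (fun i => (((f i).eval (n : ℤ)).toNat).divisors),
    if y < ∏ i, (d i : ℝ) then ∏ i, ((ArithmeticFunction.moebius (d i) : ℝ) * Real.log (d i)) else 0

/-- The NATURAL tail summand at cut-off `y`: same tuples, weight `∏ᵢ μ(dᵢ) log(fᵢ(n)/dᵢ)`
(log on the cofactor, as in `Λ = μ ∗ log`; the `e = 1` corner carries weight `0`). -/
noncomputable def naturalTailAt {k : ℕ} (f : Fin k → ℤ[X]) (y : ℝ) (n : ℕ) : ℝ :=
  ∑ d ∈ Fintype.piFinset (fun i => (((f i).eval (n : ℤ)).toNat).divisors),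
    if y < ∏ i, (d i : ℝ) then
      ∏ i, ((ArithmeticFunction.moebius (d i) : ℝ) *
        Real.log ((((f i).eval (n : ℤ)).toNat : ℝ) / (d i : ℝ))) else 0

/-- C⁺ of card `natural-log-cutoff-normal-form`: the natural tail beyond the LOG cut-off
`x/(log x)^(2k+2)` is `o(x)` (the strip down to `x^{1-η}` being Type-I-trivial for any exponent
`> 2k - 1`; `2k + 2` is a safe canonical choice). -/
def NaturalLogTail : Prop :=
  ∀ (k : ℕ) (f : Fin k → ℤ[X]), Literature.NumberTheory.Sieve.IsBatemanHornSystem f →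
    (fun x : ℕ => ∑ n ∈ Finset.Icc 1 x, naturalTailAt f ((x : ℝ) / Real.log x ^ (2 * k + 2)) n)
      =o[atTop] fun x : ℕ => (x : ℝ)

/-- First bridge (transfer, theorem-grade): at the common cut-off `x^{1-η}`,
`(-1)^k · routeTail − naturalTail` sums to `o(x)`.  Proof sketch: pointwise in `n`,
`∑_{all tuples} ∏ μ(dᵢ)[(-1)^k ∏ log dᵢ − ∏ (Lᵢ − log dᵢ)]` (`Lᵢ = log fᵢ(n)`) telescopes to
`−∑_{S ≠ ∅} ∏_{i∈S} Lᵢ · (Type-I sums carrying a bare μ(dᵢ) in the coordinates i ∈ S)`, whose main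
terms vanish by Landau's theorem `∑_{d ≤ y} μ(d)ρ(d)/d → 0` with de la Vallée-Poussin rate (tree:
`Literature.NumberTheory.LFunctions.abs_logRieszMean_moebius_rootCount_sub_le`). -/
def RouteTailToNaturalTail : Prop :=
  ∀ (k : ℕ) (f : Fin k → ℤ[X]), Literature.NumberTheory.Sieve.IsBatemanHornSystem f →
    ∀ η : ℝ, 0 < η → η < 1 →
      (fun x : ℕ => ∑ n ∈ Finset.Icc 1 x,
          ((-1 : ℝ) ^ k * routeTailAt f ((x : ℝ) ^ (1 - η)) n - naturalTailAt f ((x : ℝ) ^ (1 - η)) n))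
        =o[atTop] fun x : ℕ => (x : ℝ)

/-- Second bridge (theorem-grade, the Type-I-trivial strip): for `η ∈ (0,1)` the natural tail
between the cut-offs `x^{1-η}` and `x/(log x)^(2k+2)` sums to `o(x)` (count `xρ(d)/lcm(d) + O(ρ(d))`,
error `≪ x/(log x)^2`, main term a difference of convergent Landau sums). -/
def NaturalStripNegligible : Prop :=
  ∀ (k : ℕ) (f : Fin k → ℤ[X]), Literature.NumberTheory.Sieve.IsBatemanHornSystem f →
    ∀ η : ℝ, 0 < η → η < 1 →
      (fun x : ℕ => ∑ n ∈ Finset.Icc 1 x,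
          (naturalTailAt f ((x : ℝ) ^ (1 - η)) n -
            naturalTailAt f ((x : ℝ) / Real.log x ^ (2 * k + 2)) n))
        =o[atTop] fun x : ℕ => (x : ℝ)

/-- The glue of card 1 (pure algebra + `IsLittleO.add`): the three statements give the crux,
with `η = 1/2`. -/
theorem polyMobiusTail_of (h₁ : RouteTailToNaturalTail) (h₂ : NaturalStripNegligible)
    (h₃ : NaturalLogTail) :
    Summit.Parity.BatemanHorn.Theses.PolynomialMobius.PolyMobiusTail := by
  intro k f hf
  refine ⟨1 / 2, by norm_num, by norm_num, ?_⟩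
  have e1 := h₁ k f hf (1 / 2) (by norm_num) (by norm_num)
  have e2 := h₂ k f hf (1 / 2) (by norm_num) (by norm_num)
  have e3 := h₃ k f hf
  have e := ((e1.add e2).add e3).const_mul_left ((-1 : ℝ) ^ k)
  refine e.congr' (Eventually.of_forall fun x => ?_) EventuallyEq.rfl
  have hk : ((-1 : ℝ) ^ k) * ((-1 : ℝ) ^ k) = 1 := by
    rw [← mul_pow]; norm_num
  beta_reduce
  rw [← Finset.sum_add_distrib, ← Finset.sum_add_distrib, Finset.mul_sum]
  refine Finset.sum_congr rfl fun n _ => ?_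
  have : (-1 : ℝ) ^ k * ((-1 : ℝ) ^ k * routeTailAt f ((x : ℝ) ^ (1 - 1 / 2 : ℝ)) n
      - naturalTailAt f ((x : ℝ) ^ (1 - 1 / 2 : ℝ)) n
      + (naturalTailAt f ((x : ℝ) ^ (1 - 1 / 2 : ℝ)) n
        - naturalTailAt f ((x : ℝ) / Real.log x ^ (2 * k + 2)) n)
      + naturalTailAt f ((x : ℝ) / Real.log x ^ (2 * k + 2)) n)
      = routeTailAt f ((x : ℝ) ^ (1 - 1 / 2 : ℝ)) n := by
    have : (-1 : ℝ) ^ k * ((-1 : ℝ) ^ k * routeTailAt f ((x : ℝ) ^ (1 - 1 / 2 : ℝ)) n)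
        = routeTailAt f ((x : ℝ) ^ (1 - 1 / 2 : ℝ)) n := by rw [← mul_assoc, hk, one_mul]
    linarith
  rw [this]
  rfl

/-! ### Card 2: the affine-twist identity and Siegel–Walfisz-strength Hooley sums -/

/-- The affine twist `G_{c,c',q}(X) = ∑ᵢ aᵢ c^{deg f - i} (qX − c')^i = c^{deg f} f((qX − c')/c)`. -/
noncomputable def affineTwist (f : ℤ[X]) (c c' q : ℤ) : ℤ[X] :=
  f.sum fun i a => Polynomial.C (a * c ^ (f.natDegree - i)) * (Polynomial.C q * X - Polynomial.C c') ^ i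

/-- Root set of an integer polynomial modulo `ℓ`. -/
noncomputable def rootsMod (f : ℤ[X]) (ℓ : ℕ) : Finset (ZMod ℓ) :=
  if h : ℓ = 0 then ∅ else
    haveI : NeZero ℓ := ⟨h⟩
    (Finset.univ : Finset (ZMod ℓ)).filter fun k => (f.map (Int.castRingHom (ZMod ℓ))).eval k = 0

/-- FIRST LEMMA of the lever (PROVED below: `affineTwistRootSum_holds`; a reindexing): for `ℓ ≥ 1` and `c, q` invertible mod `ℓ`,
`∑_{k : f(k) ≡ 0 (ℓ)} ψ((c k + c') q⁻¹) = ∑_{z : G_{c,c',q}(z) ≡ 0 (ℓ)} ψ(z)` for EVERY test function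
`ψ` on `ZMod ℓ` — with `ψ = e(h·/ℓ)` the left side is the Kloosterman-twisted root Weyl sum that the
Type-I/II (Vaughan) treatment of `μ(d)` on the modulus produces, the right side a PLAIN Hooley sum. -/
def AffineTwistRootSum : Prop :=
  ∀ (f : ℤ[X]) (ℓ : ℕ) [NeZero ℓ] (c c' q : ℤ) (ψ : ZMod ℓ → ℂ),
    IsUnit ((c : ZMod ℓ)) → IsUnit ((q : ZMod ℓ)) →
      ∑ k ∈ rootsMod f ℓ, ψ (((c : ZMod ℓ) * k + (c' : ZMod ℓ)) * (q : ZMod ℓ)⁻¹) =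
        ∑ z ∈ rootsMod (affineTwist f c c' q) ℓ, ψ z

/-- Evaluation of the affine twist modulo `ℓ`: `Ḡ(z) = ∑ᵢ āᵢ c̄^{g-i} (q̄ z - c̄')^i`. -/
theorem eval_map_affineTwist (f : ℤ[X]) (c c' q : ℤ) {R : Type*} [CommRing R] (φ : ℤ →+* R) (z : R) :
    ((affineTwist f c c' q).map φ).eval z =
      ∑ i ∈ f.support, φ (f.coeff i) * φ c ^ (f.natDegree - i) * (φ q * z - φ c') ^ i := by
  unfold affineTwist
  rw [Polynomial.sum_def, Polynomial.map_sum, Polynomial.eval_finsetSum]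
  refine Finset.sum_congr rfl fun i _ => ?_
  simp [Polynomial.map_mul, Polynomial.map_pow, Polynomial.map_sub, map_mul, map_pow]

/-- At `z` with `q̄ z - c̄' = c̄ k` the twist evaluates to `c̄^{deg f} · f̄(k)`. -/
theorem eval_map_affineTwist_of_eq (f : ℤ[X]) (c c' q : ℤ) {R : Type*} [CommRing R] (φ : ℤ →+* R)
    (z k : R) (hz : φ q * z - φ c' = φ c * k) :
    ((affineTwist f c c' q).map φ).eval z = φ c ^ f.natDegree * (f.map φ).eval k := by
  rw [eval_map_affineTwist, hz, Polynomial.eval_map, Polynomial.eval₂_eq_sum, Polynomial.sum_def,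
    Finset.mul_sum]
  refine Finset.sum_congr rfl fun i hi => ?_
  have hle : i ≤ f.natDegree := Polynomial.le_natDegree_of_mem_supp i hi
  rw [mul_pow]
  have : φ c ^ (f.natDegree - i) * φ c ^ i = φ c ^ f.natDegree := by
    rw [← pow_add, Nat.sub_add_cancel hle]
  calc φ (f.coeff i) * φ c ^ (f.natDegree - i) * (φ c ^ i * k ^ i)
      = φ (f.coeff i) * (φ c ^ (f.natDegree - i) * φ c ^ i) * k ^ i := by ring
    _ = φ c ^ f.natDegree * (φ (f.coeff i) * k ^ i) := by rw [this]; ring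

theorem affineTwistRootSum_holds : AffineTwistRootSum := by
  intro f ℓ _ c c' q ψ hc hq
  have hℓ : ℓ ≠ 0 := NeZero.ne ℓ
  set φ := Int.castRingHom (ZMod ℓ) with hφ
  have hcφ : φ c = (c : ZMod ℓ) := by simp [hφ]
  have hqφ : φ q = (q : ZMod ℓ) := by simp [hφ]
  have hc'φ : φ c' = (c' : ZMod ℓ) := by simp [hφ]
  -- membership characterisations
  have memf : ∀ k, k ∈ rootsMod f ℓ ↔ (f.map φ).eval k = 0 := by
    intro k; simp [rootsMod, hℓ, hφ]
  have memG : ∀ z, z ∈ rootsMod (affineTwist f c c' q) ℓ ↔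
      ((affineTwist f c c' q).map φ).eval z = 0 := by
    intro z; simp [rootsMod, hℓ, hφ]
  have hcu : (c : ZMod ℓ) * (c : ZMod ℓ)⁻¹ = 1 := ZMod.mul_inv_of_unit _ hc
  have hqu : (q : ZMod ℓ) * (q : ZMod ℓ)⁻¹ = 1 := ZMod.mul_inv_of_unit _ hq
  have hcpow : IsUnit ((c : ZMod ℓ) ^ f.natDegree) := hc.pow _
  -- the bijection k ↦ (c k + c') q⁻¹ with inverse z ↦ (q z - c') c⁻¹
  refine Finset.sum_nbij' (fun k => ((c : ZMod ℓ) * k + (c' : ZMod ℓ)) * (q : ZMod ℓ)⁻¹)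
    (fun z => ((q : ZMod ℓ) * z - (c' : ZMod ℓ)) * (c : ZMod ℓ)⁻¹) ?_ ?_ ?_ ?_ ?_
  · -- roots of f go to roots of the twist
    intro k hk
    rw [memf] at hk
    rw [memG]
    have hz : φ q * ((((c : ZMod ℓ) * k + (c' : ZMod ℓ)) * (q : ZMod ℓ)⁻¹)) - φ c' = φ c * k := by
      rw [hqφ, hc'φ, hcφ]
      calc (q : ZMod ℓ) * (((c : ZMod ℓ) * k + (c' : ZMod ℓ)) * (q : ZMod ℓ)⁻¹) - (c' : ZMod ℓ)
          = ((q : ZMod ℓ) * (q : ZMod ℓ)⁻¹) * ((c : ZMod ℓ) * k + (c' : ZMod ℓ)) - (c' : ZMod ℓ) := by ring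
        _ = (c : ZMod ℓ) * k := by rw [hqu]; ring
    rw [eval_map_affineTwist_of_eq f c c' q φ _ k hz, hk, mul_zero]
  · -- roots of the twist go back to roots of f
    intro z hz
    rw [memG] at hz
    rw [memf]
    have hk : φ q * z - φ c' = φ c * ((((q : ZMod ℓ) * z - (c' : ZMod ℓ)) * (c : ZMod ℓ)⁻¹)) := by
      rw [hqφ, hc'φ, hcφ]
      calc (q : ZMod ℓ) * z - (c' : ZMod ℓ)
          = ((c : ZMod ℓ) * (c : ZMod ℓ)⁻¹) * ((q : ZMod ℓ) * z - (c' : ZMod ℓ)) := by rw [hcu]; ring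
        _ = (c : ZMod ℓ) * (((q : ZMod ℓ) * z - (c' : ZMod ℓ)) * (c : ZMod ℓ)⁻¹) := by ring
    rw [eval_map_affineTwist_of_eq f c c' q φ z _ hk, hcφ] at hz
    exact (hcpow.mul_right_eq_zero).mp hz
  · -- left inverse
    intro k _
    calc ((q : ZMod ℓ) * ((((c : ZMod ℓ) * k + (c' : ZMod ℓ)) * (q : ZMod ℓ)⁻¹)) - (c' : ZMod ℓ)) * (c : ZMod ℓ)⁻¹
        = (((q : ZMod ℓ) * (q : ZMod ℓ)⁻¹) * ((c : ZMod ℓ) * k + (c' : ZMod ℓ)) - (c' : ZMod ℓ)) * (c : ZMod ℓ)⁻¹ := by ring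
      _ = ((c : ZMod ℓ) * (c : ZMod ℓ)⁻¹) * k := by rw [hqu]; ring
      _ = k := by rw [hcu, one_mul]
  · -- right inverse
    intro z _
    calc ((c : ZMod ℓ) * ((((q : ZMod ℓ) * z - (c' : ZMod ℓ)) * (c : ZMod ℓ)⁻¹)) + (c' : ZMod ℓ)) * (q : ZMod ℓ)⁻¹
        = (((c : ZMod ℓ) * (c : ZMod ℓ)⁻¹) * ((q : ZMod ℓ) * z - (c' : ZMod ℓ)) + (c' : ZMod ℓ)) * (q : ZMod ℓ)⁻¹ := by ring
      _ = ((q : ZMod ℓ) * (q : ZMod ℓ)⁻¹) * z := by rw [hcu]; ring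
      _ = z := by rw [hqu, one_mul]
  · intro k _; rfl


/-- Hooley's root Weyl sum at frequency `h` over all moduli `ℓ ≤ L` coprime to `m`. -/
noncomputable def hooleySum (G : ℤ[X]) (h : ℤ) (m L : ℕ) : ℂ :=
  ∑ ℓ ∈ (Finset.Icc 1 L).filter (fun ℓ => Nat.Coprime ℓ m),
    ∑ z ∈ rootsMod G ℓ, Complex.exp (2 * Real.pi * Complex.I * (h : ℂ) * ((z.val : ℂ) / (ℓ : ℂ)))

/-- TARGET of card 2 (open; = roots mod primes at Siegel–Walfisz strength, see card):
log-power saving in Hooley sums, uniform over the polylog affine orbit of `f`. -/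
def SWHooleyAffine (f : ℤ[X]) : Prop :=
  ∀ A : ℝ, 0 < A → ∀ P : ℝ, 0 < P → ∃ C : ℝ, ∀ L : ℕ, 2 ≤ L →
    ∀ (c c' q h : ℤ) (m : ℕ), c ≠ 0 → q ≠ 0 → h ≠ 0 →
      max (max |c| |c'|) (max |q| |h|) ≤ Real.log L ^ P → (m : ℝ) ≤ Real.log L ^ P →
        ‖hooleySum (affineTwist f c c' q) h m L‖ ≤ C * L / Real.log L ^ A

end Summit.Parity.BatemanHorn.Cruxes.PolyMobiusTail.Ideator2
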